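import Summits.AtomisticToContinuum.HydrodynamicLimit.Theorems.InformationPercolationEnginePercolationClosesChaosForecastRobustDefs
import Summits.AtomisticToContinuum.HydrodynamicLimit.Theorems.InformationPercolationEnginePercolationClosesChaosForecastBadForecastRare
import HarnessLib

/-!
# Forecast transfer W5 of the line `equilibrium-forecast-chain-rule` (crux `InformationPercolationEngine.PercolationClosesChaos`,
stmt-AtomisticToContinuum-15178) — piece H2_B of skeleton v9: `MesoForecastChaosB → BadForecastRareB`

Support file (`--supports stmt-AtomisticToContinuum-15178`) of the registered stub `badForecastRareB_of` (worker W5 of lead c4):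
the re-typed second hypothesis `BadForecastRareB` (§R5 of `…ForecastRobustDefs`) of the weighted architecture is DISCHARGED from
`MesoForecastChaosB` (§R3 ibid.) exactly as the v5 piece `badForecastRare_of_forecastChaos` (`…ForecastBadForecastRare`):
the integrand of `BadForecastRareB` is the integrand of `MesoForecastChaosB` by `rfl` (`gForecast` unfolds to its `condExp`; the
BINNED guard `GoodUnitB b` is the same on both sides), the extra quantifier layer `∃ b₀ ∀ b ≤ b₀` after `c` is passed through, and
the in-mean entropy transfer `G_N → LG` of `exists_lgTransferConst` at `δ' = δ₂/2`, `L = 54 (log 2 + A)/δ₂`, `M = 27`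
(`unitAvg_le_twentySeven` once `c ℓ_N ≤ 1`, `exists_mesh_le_one`; box support from `gForecast_badWeight_eq_zero_of_not_mem`)
gives `∫ V dLG ≤ δ₂/2 + 27 (log 2 + A)/L = δ₂`.
-/

noncomputable section

open MeasureTheory Set Filter Topology
open scoped ENNReal BigOperators Classical
open Literature.Analysis.FluidPDE Literature.MathematicalPhysics.KineticTheory
open Literature.MathematicalPhysics.KineticTheory.VelocityBlindPlacement

namespace Summit.AtomisticToContinuum.HydrodynamicLimit.Theorems.EquilibriumForecastLine

/-! ## H2_B from binned forecast chaos under the invariant law -/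

/-- **`MesoForecastChaosB → BadForecastRareB`** (H2_B of the weighted architecture, discharged; skeleton v9): `MesoForecastChaosB`
verbatim at `(δ' = δ₂/2, L = 54 (log 2 + A)/δ₂)`, the bin-width threshold `b₀(c)` passed through, and the in-mean transfer of
`exists_lgTransferConst` with `M = 27`. [folklore] -/
theorem badForecastRareB_of : MesoForecastChaosB → BadForecastRareB := by
  intro hmce
  obtain ⟨φs, hφs, σ₁, hσ₁, H⟩ := hmce
  refine ⟨φs, hφs, σ₁, hσ₁, ?_⟩
  intro a₀ θ₀ u₀ ha hθ hu ha0 hθ0 σ hσ hσ₁' hhalf Φ τ hτ Ψ hΨ hΨb ϑs η δ T δ₂ hϑs hη hδ hT hδ₂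
  obtain ⟨A, hA, hLG⟩ := exists_lgTransferConst ha hθ hu ha0 hθ0 hhalf
  have hl2 : 0 < Real.log 2 := Real.log_pos one_lt_two
  have hL : 0 < 54 * (Real.log 2 + A) / δ₂ := by positivity
  obtain ⟨ϑ, hϑ, c₀, hc₀, Hc⟩ := H σ hσ hσ₁' Φ τ hτ Ψ hΨ hΨb ϑs η δ T (δ₂ / 2) (54 * (Real.log 2 + A) / δ₂)
    hϑs hη hδ hT (by positivity) hL
  refine ⟨ϑ, hϑ, c₀, hc₀, fun c hc => ?_⟩
  -- the bin-width threshold `b₀(c)` of `MesoForecastChaosB` is passed through unchanged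
  obtain ⟨b₀, hb₀, Hb⟩ := Hc c hc
  refine ⟨b₀, hb₀, fun b hb hbb => ?_⟩
  obtain ⟨N₀, HN⟩ := Hb b hb hbb
  obtain ⟨N₁, HN₁⟩ := exists_mesh_le_one hσ c
  refine ⟨max N₀ N₁, fun N hN => ?_⟩
  have hN₀ : N₀ ≤ N := (le_max_left _ _).trans hN
  have hN₁ : N₁ ≤ N := (le_max_right _ _).trans hN
  have hc0 : 0 < c := hc₀.trans_le hc
  have hh : 0 < c * meanFreePath σ N := mul_pos hc0 (meanFreePath_pos hσ N)
  obtain ⟨-, -, -, -, htr⟩ := hLG N (Φ N)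
  -- the unit-fraction of binned-good units with a bad forecast, as a function of the datum
  set V : Phase N → ℝ := fun z => unitAvg c σ N τ fun k q =>
    if GoodUnitB b ϑs ϑ φs c σ N ((Φ N).flow ((k : ℝ) * stepLen c σ N) z) q ∧
        δ < gForecast b c σ N (Φ N) (badWeight Ψ η T c σ N (Φ N)) k q z
    then 1 else 0 with hV
  have hbox : ∀ (z : Phase N) (k : ℕ), ∀ q ∉ cellBox (c * meanFreePath σ N),
      (if GoodUnitB b ϑs ϑ φs c σ N ((Φ N).flow ((k : ℝ) * stepLen c σ N) z) q ∧
          δ < gForecast b c σ N (Φ N) (badWeight Ψ η T c σ N (Φ N)) k q z then (1 : ℝ) else 0) = 0 := by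
    intro z k q hq
    rw [if_neg]
    rintro ⟨-, hlt⟩
    rw [gForecast_badWeight_eq_zero_of_not_mem (Φ N) hh Ψ η hT.le k hq, Pi.zero_apply] at hlt
    exact lt_irrefl _ (hδ.trans hlt)
  have hV0 : ∀ z, 0 ≤ V z := fun z =>
    unitAvg_nonneg hh.le (hbox z) fun k q => by positivity
  have hV27 : ∀ z, V z ≤ 27 := fun z =>
    unitAvg_le_twentySeven τ hh (HN₁ N hN₁) (hbox z) fun k q => by split_ifs <;> norm_num
  have hE : eqLaw σ N (Φ N) {z | δ₂ / 2 < V z} ≤ ENNReal.ofReal (Real.exp (-(54 * (Real.log 2 + A) / δ₂ * ((N : ℝ) + 1)))) :=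
    HN N hN₀
  have hint := htr V (δ₂ / 2) 27 (54 * (Real.log 2 + A) / δ₂) (by positivity) (by norm_num) hV0 hV27 hL hE
  have hcalc : δ₂ / 2 + 27 * ((Real.log 2 + A) / (54 * (Real.log 2 + A) / δ₂)) = δ₂ := by
    have hne : Real.log 2 + A ≠ 0 := by positivity
    field_simp
    ring
  calc unitMean c σ N τ (localGibbsLaw σ a₀ u₀ θ₀ N (Φ N)) (fun k q z =>
        if GoodUnitB b ϑs ϑ φs c σ N ((Φ N).flow ((k : ℝ) * stepLen c σ N) z) q ∧
            δ < gForecast b c σ N (Φ N) (badWeight Ψ η T c σ N (Φ N)) k q z then 1 else 0)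
      = ∫ z, V z ∂(localGibbsLaw σ a₀ u₀ θ₀ N (Φ N)) := rfl
    _ ≤ δ₂ / 2 + 27 * ((Real.log 2 + A) / (54 * (Real.log 2 + A) / δ₂)) := hint
    _ = δ₂ := hcalc

end Summit.AtomisticToContinuum.HydrodynamicLimit.Theorems.EquilibriumForecastLine

end
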